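/-
Origin: expansion seat `planner-pub-hodgecm-pv13-g2-0`, handover #3 2026-08-18T05:18:36Z (`HOME/pub-hodgecm-pv13-g2/lean/Pv13/Li92PerL.lean`, md5 232f592e, 105 lines);
landed by the gen-6 packager in gate run 22 as `HodgeCM/PerL34/Li92PerL.lean` (import ^import Pv[0-9]+\.→import HodgeCM.PerL34. ×1).
-/
/-
Origin: pub-hodgecm-pv13-g2 (DAG-NODE PROVER #13, gen 2; session planner-pub-hodgecm-pv13-g2-0) — the one-line applications
the carver's `AssemblyRoutes.lean` (carver-g2 HANDOVER #4, 05:09:26Z) deliberately leaves out ("route B … a one-line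
application once that file lands (kept OUT of this file so that it does not inherit the `ThetaCorrespondence` v3 ordering
constraint)"): PerL (node N34) with seam S3 fed BY NAME from the Li92 route of `Li92Bridge` / `Li92FromPieces`.
Imports: `HodgeCM.PerL34.AssemblyRoutes` (carver-g2 #4 bae41223, after `AssemblyWeil` v3), `HodgeCM.PerL34.Li92FromPieces`
(this seat #2, after `Li92Bridge` #1 and gen-1 `SideFromPieces`; `Li92Bridge` after cf-kudla-howe-rallis-g2
`ThetaCorrespondence` v3) — this file lands AFTER all of them (run 23 if any of them is run 23).
Proposed place: `HodgeCM/PerL34/Li92PerL.lean`, namespace `HodgeCM.PerL34.Li92Route`.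
Nothing cited, nothing asserted: KERNEL glue (three applications).
-/
import Summits.HodgeConjecture.HodgeCM.PerL34.AssemblyRoutes
import Summits.HodgeConjecture.HodgeCM.PerL34.Li92FromPieces

set_option autoImplicit false

/-!
# PerL with Lemma 4.2(b) from [Li92 Cor 5.5] by name

Binder census of `perL_of_li92PrintWeilLeaves` (ROUTE B, print-only N31): `M : U.ModelAxioms`; PRINT leaves `h07`
(Hodge–Riemann), `h09a`/`h09b` ([BW] VII embedding/cover), `h12b` (sign recipe), `hM38 : U.Fact_cmInflation` (Shimura 1998
§6.2 Thm 3; class-M candidate), `hAlb : T.Fact_thetaAlbanese` ([Liu21] Prop 4.13 + Thm 4.18); instantiation records `hbr`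
(pv11 `SeesawBridge`), `hQ` (pv02-g2 `QautBridge`), `Pc/A12/A34` (pv06 `ArchCDatum`); `hW : CharSpansWeil.WeilStepsInput T`
(pv03, seams S1+S2); and for seam S3 = node N31 = Lemma 4.2(b): `hP : Li92Route.PrintInputs T` — per good context an
`Ambient` (D2) and per torus side an `OccSide` = two `LineDict`s (PRINT field `cor55 : G.StableRangeNonvanishing` =
[Li92, Cor 5.5, p. 206] verbatim, cf-kudla-howe-rallis-g2; D4 dictionary fields; the archimedean residual (r1)
`inA10_of_howe`) + (r3) `allowed_of` (Definition 3.2) + (r1a) archimedean occurrence `occ₁/occ₂` — and NO doubling /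
Siegel–Weil / Rallis-inner-product / local-factor / Euler-product input (nodes N31b–N31h (i) are Li's printed proof).
`perL_of_li92AnalyticWeilLeaves` (ROUTE A′: `AnalyticInputs T`, PerL v5 as written with `allowed_of_pair` derived) and
`perL_of_li92PiecesWeilLeaves` (ROUTE A from gen-1's per-character `LocalFactorPieces` + the Li92 side dictionaries, via
`ClusterOutputs T`) are the other two keys.
-/

noncomputable section

namespace HodgeCM
namespace PerL34
namespace Li92Route

open HodgeCM.Prior.Perl34File HodgeCM.Prior.Perl34File.Perl34 HodgeCM.PerL34.ArchC
open HodgeCM.PerL34.AssemblyRoutes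

variable {U : Universe}

/-- **PerL (N34), ROUTE B: Lemma 4.2(b) from [Li92 Cor 5.5] + dictionary + archimedean occurrence, nothing analytic.**
PROVED (kernel glue over the carver's `perL_of_openCharsWeilLeaves`). -/
theorem perL_of_li92PrintWeilLeaves (M : U.ModelAxioms) (T : U.ThetaModel)
    (h07 : N07_hodgeRiemann20 U) (h09a : N09a_embCover T) (h09b : N09b_innerEmb T)
    (hM38 : U.Fact_cmInflation) (hAlb : T.Fact_thetaAlbanese) (h12b : N12b_signRecipe T)
    (hbr : ∀ {L : CMField} {ι₁ : L →+* ℂ} (V : HermSpace3 L ι₁) (c : SeesawCtx L), T.GoodCtx ι₁ c →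
      Nonempty (SeesawDictionary.SeesawBridge T V c (T.t12 V c) 0 1))
    (hQ : ∀ {L : CMField} {ι₁ : L →+* ℂ} (V : HermSpace3 L ι₁) (c : SeesawCtx L), T.GoodCtx ι₁ c →
      Nonempty (QautDictionary.QautBridge T V c (T.t34 V c) 2 3))
    (Pc : ∀ {L : CMField} {ι₁ : L →+* ℂ} (V : HermSpace3 L ι₁) (c : SeesawCtx L),
      C4a.PointedCore (T.core V c))
    (A12 : ∀ {L : CMField} {ι₁ : L →+* ℂ} (V : HermSpace3 L ι₁) (c : SeesawCtx L),
      T.GoodCtx ι₁ c → Nonempty (ArchCDatum (T.core V c) (T.t12 V c) (Pc V c)))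
    (A34 : ∀ {L : CMField} {ι₁ : L →+* ℂ} (V : HermSpace3 L ι₁) (c : SeesawCtx L),
      T.GoodCtx ι₁ c → Nonempty (ArchCDatum (T.core V c) (T.t34 V c) (Pc V c)))
    (hP : PrintInputs T) (hW : CharSpansWeil.WeilStepsInput T) : U.PerL :=
  perL_of_openCharsWeilLeaves M T h07 h09a h09b hM38 hAlb h12b hbr hQ Pc A12 A34 (open_chars_of_print T hP) hW

/-- **PerL (N34), ROUTE A′: PerL v5 as written, the analytic side data of `Li92Bridge` (`SideOutputs.allowed_of_pair`
derived) in every good context.**  PROVED. -/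
theorem perL_of_li92AnalyticWeilLeaves (M : U.ModelAxioms) (T : U.ThetaModel)
    (h07 : N07_hodgeRiemann20 U) (h09a : N09a_embCover T) (h09b : N09b_innerEmb T)
    (hM38 : U.Fact_cmInflation) (hAlb : T.Fact_thetaAlbanese) (h12b : N12b_signRecipe T)
    (hbr : ∀ {L : CMField} {ι₁ : L →+* ℂ} (V : HermSpace3 L ι₁) (c : SeesawCtx L), T.GoodCtx ι₁ c →
      Nonempty (SeesawDictionary.SeesawBridge T V c (T.t12 V c) 0 1))
    (hQ : ∀ {L : CMField} {ι₁ : L →+* ℂ} (V : HermSpace3 L ι₁) (c : SeesawCtx L), T.GoodCtx ι₁ c →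
      Nonempty (QautDictionary.QautBridge T V c (T.t34 V c) 2 3))
    (Pc : ∀ {L : CMField} {ι₁ : L →+* ℂ} (V : HermSpace3 L ι₁) (c : SeesawCtx L),
      C4a.PointedCore (T.core V c))
    (A12 : ∀ {L : CMField} {ι₁ : L →+* ℂ} (V : HermSpace3 L ι₁) (c : SeesawCtx L),
      T.GoodCtx ι₁ c → Nonempty (ArchCDatum (T.core V c) (T.t12 V c) (Pc V c)))
    (A34 : ∀ {L : CMField} {ι₁ : L →+* ℂ} (V : HermSpace3 L ι₁) (c : SeesawCtx L),
      T.GoodCtx ι₁ c → Nonempty (ArchCDatum (T.core V c) (T.t34 V c) (Pc V c)))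
    (hA : AnalyticInputs T) (hW : CharSpansWeil.WeilStepsInput T) : U.PerL :=
  perL_of_openCharsWeilLeaves M T h07 h09a h09b hM38 hAlb h12b hbr hQ Pc A12 A34 (open_chars_of_analytic T hA) hW

/-- **PerL (N34), ROUTE A from pieces: gen-1's per-character `LocalFactorPieces` + the Li92 side dictionaries in every
good context (`Li92ClusterPieces`), through `ClusterOutputs T` and the carver's `perL_of_clusterWeilLeaves`.**  PROVED. -/
theorem perL_of_li92PiecesWeilLeaves (M : U.ModelAxioms) (T : U.ThetaModel) {Pl : Type} [Countable Pl]
    (h07 : N07_hodgeRiemann20 U) (h09a : N09a_embCover T) (h09b : N09b_innerEmb T)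
    (hM38 : U.Fact_cmInflation) (hAlb : T.Fact_thetaAlbanese) (h12b : N12b_signRecipe T)
    (hbr : ∀ {L : CMField} {ι₁ : L →+* ℂ} (V : HermSpace3 L ι₁) (c : SeesawCtx L), T.GoodCtx ι₁ c →
      Nonempty (SeesawDictionary.SeesawBridge T V c (T.t12 V c) 0 1))
    (hQ : ∀ {L : CMField} {ι₁ : L →+* ℂ} (V : HermSpace3 L ι₁) (c : SeesawCtx L), T.GoodCtx ι₁ c →
      Nonempty (QautDictionary.QautBridge T V c (T.t34 V c) 2 3))
    (Pc : ∀ {L : CMField} {ι₁ : L →+* ℂ} (V : HermSpace3 L ι₁) (c : SeesawCtx L),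
      C4a.PointedCore (T.core V c))
    (A12 : ∀ {L : CMField} {ι₁ : L →+* ℂ} (V : HermSpace3 L ι₁) (c : SeesawCtx L),
      T.GoodCtx ι₁ c → Nonempty (ArchCDatum (T.core V c) (T.t12 V c) (Pc V c)))
    (A34 : ∀ {L : CMField} {ι₁ : L →+* ℂ} (V : HermSpace3 L ι₁) (c : SeesawCtx L),
      T.GoodCtx ι₁ c → Nonempty (ArchCDatum (T.core V c) (T.t34 V c) (Pc V c)))
    (hA : ∀ {L : CMField} {ι₁ : L →+* ℂ} (V : HermSpace3 L ι₁) (c : SeesawCtx L), T.GoodCtx ι₁ c →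
      Nonempty (Li92ClusterPieces T V c Pl))
    (hW : CharSpansWeil.WeilStepsInput T) : U.PerL :=
  perL_of_clusterWeilLeaves M T h07 h09a h09b hM38 hAlb h12b hbr hQ Pc A12 A34 (clusterOutputs_of_li92Pieces T hA) hW

end Li92Route
end PerL34
end HodgeCM

end
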